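import Summits.FinalStateConjecture.FinalStateConjecture.Theorems.PhotonSphereChannelsUniformPhotonSphereChannelsRMajorantQBound

/-!
# Crux `UniformPhotonSphereChannelsR` (K1R), line `crum-peeling-recessive-tower` —
# Theorem A, rung step (A3), part 4/5: the H-bound

`H_scaled_le`: the scaled image of the rung map satisfies `|H n| ρⁿ ≤ (2ρ/n²) σ^(n−1)` with
`σ = (1 + Δ_λ/B)/(1 − 2/(2λ−1)²)`.  The exact identity
`(λ−1)(2λ−1+n) H_n = λ(2λ−1−n) G_n + 2λ(λ−1) G₁ q_{n−1} + 2(2λ−1)(n−2) G_{n−1} + R_n + piv·conv_n`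
exhibits the damping factor; the `O(ρ²)` remainder is paid by the B-drift `(n−1)Δ_λ/B`, the
coupling `G₁ q_{n−1}` by the damping (`n < 2λ`) or by the θ-schedule via `(G)` (`n ≥ 2λ`).
-/

set_option linter.dupNamespace false

noncomputable section

namespace Summit.FinalStateConjecture.FinalStateConjecture.Theorems.CrumPeelingRecessiveTower

open Finset

/-! ### The H-bound (LH) -/

section HStep

set_option maxHeartbeats 1600000 in
/-- **The H-bound (LH), scaled form of the rung step.**  With `ρ = θ/B`, the profile
hypothesis `|G i| ρ^i ≤ 2ρ/i²` and the exact relations `(Hq)`, `(Qn)`, `(α)`, the image `H` of the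
rung map satisfies `|H n| ρ^n ≤ (2ρ/n²) σ^(n-1)` with `σ = (1 + Δ_λ/B)/(1 − 2/(2λ−1)²)`,
`Δ_λ = (2λ−1)/(λ(λ−1))`: the B-drift pays the `O(ρ²)` remainders, the θ-schedule and the damping
factor `μ_n = λ(2λ−1−n)/((λ−1)(2λ−1+n))` pay the coupling term (cases `n < 2λ` / `n ≥ 2λ`,
the latter through the elementary inequality `(G)`). -/
theorem H_scaled_le :
    ∀ {lam ρ θ B : ℝ} {L : ℕ} {G H q α : ℕ → ℝ}, 2 ≤ lam → ((L : ℕ) : ℝ) = lam → 0 < ρ → 16 ≤ B → ρ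
      * B = θ → θ ≤ 1 / 1024 → |G 1| * ρ ≤ θ → (∀ i, 2 ≤ i → |G i| * ρ ^ i ≤ 2 * ρ / (i : ℝ) ^ 2) →
      α 1 = -2 → (∀ i, 2 ≤ i → α i = (1 - (i : ℝ)) * G i + 2 * ((i : ℝ) - 2) * G (i - 1)) → q 1 =
      -((2 * lam - 1) / (lam * (lam - 1))) → (∀ n, 2 ≤ n → (lam - 1) * (2 * lam - 1 + n) * q n = (2
      * lam - 1) * α n - (lam - 1) * G 1 * ((n : ℝ) - 1) * q (n - 1) - (lam - 1) * ∑ i ∈ Finset.Ico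
      2 n, G i * ((n : ℝ) - i) * q (n - i) + 2 * (lam - 1) * (((n : ℝ) - 1) * q (n - 1) + G 1 * ((n
      : ℝ) - 2) * q (n - 2) + ∑ i ∈ Finset.Ico 2 (n - 1), G i * ((n : ℝ) - 1 - i) * q (n - 1 - i)) -
      lam * (lam - 1) * ∑ i ∈ Finset.Ico 1 n, q i * q (n - i) + (3 * lam - 1) * ∑ i ∈ Finset.Ico 1
      n, α i * q (n - i) + lam * ∑ i ∈ Finset.Ico 1 (n - 1), α i * ∑ j ∈ Finset.Ico 1 (n - i), q j *
      q (n - i - j)) → (∀ n, 2 ≤ n → H n = G n + q n + G 1 * q (n - 1) + ∑ i ∈ Finset.Ico 2 n, G i *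
      q (n - i)) → (∀ n : ℕ, 2 ≤ n → ∑ i ∈ Finset.Ico 2 n, (1 / ((i : ℝ) ^ 2)) * (1 / ((((n - i : ℕ)
      : ℝ)) * (2 * lam - 1 + ((n - i : ℕ) : ℝ)))) ≤ 16 * (((n : ℝ) - 1) / n) * (1 / ((n : ℝ) * (2 *
      lam - 1 + n)))) → (∀ m : ℕ, 2 ≤ m → ∑ i ∈ Finset.Ico 1 m, (1 / ((i : ℝ) * (2 * lam - 1 + i)))
      * (1 / ((((m - i : ℕ) : ℝ)) * (2 * lam - 1 + ((m - i : ℕ) : ℝ)))) ≤ (16 / 3) * (1 / ((m : ℝ) *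
      (2 * lam - 1 + m))) * (1 + Real.log (2 * lam)) / lam) → (∀ n : ℕ, 1 ≤ n → (n : ℝ) * ∑ i ∈
      Finset.Ico 1 n, (1 / (i : ℝ)) * (1 / ((((n - i : ℕ) : ℝ)) * (2 * lam - 1 + ((n - i : ℕ) :
      ℝ)))) ≤ 4) → (∀ n : ℕ, 2 ≤ n → ∑ i ∈ Finset.Ico 2 n, (1 / ((i : ℝ) ^ 2)) * (1 / (2 * lam - 1 +
      ((n - i : ℕ) : ℝ))) ≤ 3 / (2 * lam - 1 + n)) → (∀ n : ℕ, 2 * L ≤ n → 3 * lam / (2 * lam - 1 +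
      n) ≤ 2 * ((n : ℝ) - 1) / (2 * lam - 1) ^ 2 + 1 - lam * ((n : ℝ) + 1 - 2 * lam) / ((lam - 1) *
      (2 * lam - 1 + n))) → ∀ n, 2 ≤ n → |H n| * ρ ^ n ≤ 2 * ρ / (n : ℝ) ^ 2 * ((1 + (2 * lam - 1) /
      (lam * (lam - 1)) / B) / (1 - 2 / (2 * lam - 1) ^ 2)) ^ (n - 1) := by
  intro lam ρ θ B L G H q α hlam hL hρ hB hρB hθle hθ hG hα1 hα hq1 hQn hH hCV1 hCV2 hCV3 hCV4 hGc n hn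
  -- positivity facts
  have hl1 : 0 < lam - 1 := by linarith
  have hl0 : 0 < lam := by linarith
  have hnr : (2 : ℝ) ≤ n := by exact_mod_cast hn
  have hn0 : (0 : ℝ) < n := by linarith
  have hD : 0 < 2 * lam - 1 + n := by linarith
  have hpiv : 0 < (lam - 1) * (2 * lam - 1 + n) := mul_pos hl1 hD
  have hρ0 := hρ.le
  have hB0 : 0 < B := by linarith
  have hθ0 : 0 < θ := by rw [← hρB]; positivity
  have hρle : ρ ≤ 1 / 16384 := by
    have : ρ * 16 ≤ ρ * B := mul_le_mul_of_nonneg_left hB hρ0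
    linarith
  have hL2 : 2 ≤ L := by
    have : (2 : ℝ) ≤ (L : ℝ) := by rw [hL]; exact hlam
    exact_mod_cast this
  -- the q-bound and the α-bound
  have hq : ∀ m, 1 ≤ m → |q m| * ρ ^ m ≤ 16 * ρ * (1 / ((m : ℝ) * (2 * lam - 1 + m))) :=
    q_scaled_le hlam hρ0 hρle hθ hθle hG hα1 hα hq1 hQn hCV2 hCV3 hCV4
  have hq' : ∀ m, 1 ≤ m → m < n → |q m| * ρ ^ m ≤ 16 * ρ * (1 / ((m : ℝ) * (2 * lam - 1 + m))) :=
    fun m hm _ => hq m hm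
  have hαb := alpha_scaled_le hρ0 hρle hα1 hα hG
  -- the weight at n
  set ω : ℝ := 1 / ((n : ℝ) * (2 * lam - 1 + n)) with hωdef
  have hω0 : 0 < ω := omegaW_pos hlam (by omega : 1 ≤ n)
  have hωD : (2 * lam - 1 + n) * ω = 1 / n := by
    rw [hωdef]; field_simp
  have hlamω : lam * ω ≤ 1 / (2 * n) := by
    rw [hωdef, mul_one_div, div_le_div_iff₀ (mul_pos hn0 hD) (by positivity)]
    have := mul_nonneg hn0.le (by linarith : (0:ℝ) ≤ (n:ℝ) - 1)
    linarith
  -- the five remainders and the convolution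
  have hS3 := remainder_S3 hlam hρ0 hn hG hq' (hCV4 n hn)
  have hS4 := remainder_S4 (θ := θ) hlam hρ0 hρle hn hθ hθle hG hq'
    (fun _ => hCV4 (n - 1) (by omega))
  have hS5 := remainder_S5 hlam hρ0 hn hq' (hCV2 n hn)
  have hS6 := remainder_S6 hlam hρ0 hn hαb hq' (hCV3 n (by omega))
  have hS7 := remainder_S7 hlam hρ0 hρle hn hαb hq' (fun m hm _ => hCV2 m hm) (hCV3 n (by omega))
  have hconv := conv_scaled_le hlam hρ0 hn hG hq (hCV1 n hn)
  rw [← hωdef] at hconv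
  -- the exact identity for `piv · H n`
  have hid : (lam - 1) * (2 * lam - 1 + n) * H n
      = lam * (2 * lam - 1 - n) * G n
        + 2 * lam * (lam - 1) * (G 1 * q (n - 1))
        + 2 * (2 * lam - 1) * ((n : ℝ) - 2) * G (n - 1)
        + (-(lam - 1)) * ∑ i ∈ Finset.Ico 2 n, G i * ((n : ℝ) - i) * q (n - i)
        + 2 * (lam - 1) * (((n : ℝ) - 1) * q (n - 1) + G 1 * ((n : ℝ) - 2) * q (n - 2)
              + ∑ i ∈ Finset.Ico 2 (n - 1), G i * ((n : ℝ) - 1 - i) * q (n - 1 - i))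
        + (-(lam * (lam - 1))) * ∑ i ∈ Finset.Ico 1 n, q i * q (n - i)
        + (3 * lam - 1) * ∑ i ∈ Finset.Ico 1 n, α i * q (n - i)
        + lam * ∑ i ∈ Finset.Ico 1 (n - 1), α i * ∑ j ∈ Finset.Ico 1 (n - i), q j * q (n - i - j)
        + (lam - 1) * (2 * lam - 1 + n) * ∑ i ∈ Finset.Ico 2 n, G i * q (n - i) := by
    have e1 := hH n hn
    have e2 := hQn n hn
    have e3 := hα n hn
    linear_combination ((lam - 1) * (2 * lam - 1 + n)) * e1 + e2 + (2 * lam - 1) * e3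
  -- triangle inequality
  have habs := ((mul_le_mul_of_nonneg_right (congrArg abs hid).le (pow_nonneg hρ0 n))).trans
    (abs_add_nine_mul _ _ _ _ _ _ _ _ _ (ρ ^ n) (pow_nonneg hρ0 n))
  -- piece bounds
  have p0 : |lam * (2 * lam - 1 - n) * G n| * ρ ^ n ≤ lam * |2 * lam - 1 - n| * (2 * ρ / (n : ℝ) ^ 2) := by
    rw [abs_mul, abs_mul, abs_of_pos hl0, mul_assoc]
    exact mul_le_mul_of_nonneg_left (hG n hn) (mul_nonneg hl0.le (abs_nonneg _))
  have hpow : ρ ^ n = ρ * ρ ^ (n - 1) := by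
    rw [← pow_succ']; congr 1; omega
  have p1 : |2 * lam * (lam - 1) * (G 1 * q (n - 1))| * ρ ^ n ≤ 96 * lam * (lam - 1) * θ * ρ * ω := by
    rw [abs_mul, abs_of_pos (by positivity : 0 < 2 * lam * (lam - 1)), abs_mul, hpow]
    have hqq := hq (n - 1) (by omega)
    have hω1 := omegaW_pred_le hlam hn
    have hprod : |G 1| * |q (n - 1)| * (ρ * ρ ^ (n - 1)) ≤ θ * (16 * ρ * (3 * ω)) := by
      calc |G 1| * |q (n - 1)| * (ρ * ρ ^ (n - 1))
          = (|G 1| * ρ) * (|q (n - 1)| * ρ ^ (n - 1)) := by ring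
        _ ≤ θ * (16 * ρ * (1 / ((((n - 1 : ℕ) : ℝ)) * (2 * lam - 1 + ((n - 1 : ℕ) : ℝ))))) :=
            mul_le_mul hθ hqq (by positivity) hθ0.le
        _ ≤ θ * (16 * ρ * (3 * ω)) := by
            apply mul_le_mul_of_nonneg_left _ hθ0.le
            exact mul_le_mul_of_nonneg_left hω1 (by positivity)
    calc 2 * lam * (lam - 1) * (|G 1| * |q (n - 1)|) * (ρ * ρ ^ (n - 1))
        = 2 * lam * (lam - 1) * (|G 1| * |q (n - 1)| * (ρ * ρ ^ (n - 1))) := by ring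
      _ ≤ 2 * lam * (lam - 1) * (θ * (16 * ρ * (3 * ω))) :=
          mul_le_mul_of_nonneg_left hprod (by positivity)
      _ = 96 * lam * (lam - 1) * θ * ρ * ω := by ring
  have p2 : |2 * (2 * lam - 1) * ((n : ℝ) - 2) * G (n - 1)| * ρ ^ n ≤ 12 * (lam - 1) * ρ ^ 2 / n := by
    rcases eq_or_lt_of_le hn with h2 | h3
    · have h0 : ((n : ℝ) - 2) = 0 := by rw [← h2]; norm_num
      rw [h0, mul_zero, zero_mul, abs_zero, zero_mul]
      exact div_nonneg (mul_nonneg (mul_nonneg (by norm_num) hl1.le) (sq_nonneg _)) hn0.le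
    · have hGn := hG (n - 1) (by omega)
      have hc1 : (((n - 1 : ℕ) : ℝ)) = (n : ℝ) - 1 := by
        rw [Nat.cast_sub (by omega)]; norm_num
      rw [hc1] at hGn
      have h3r : (3 : ℝ) ≤ n := by exact_mod_cast h3
      have hcoef : 0 ≤ 2 * (2 * lam - 1) * ((n : ℝ) - 2) :=
        mul_nonneg (mul_nonneg (by norm_num) (by linarith)) (by linarith)
      rw [abs_mul, abs_of_nonneg hcoef, hpow]
      have hn1 : (0 : ℝ) < (n : ℝ) - 1 := by linarith
      calc 2 * (2 * lam - 1) * ((n : ℝ) - 2) * |G (n - 1)| * (ρ * ρ ^ (n - 1))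
          = 2 * (2 * lam - 1) * ((n : ℝ) - 2) * ρ * (|G (n - 1)| * ρ ^ (n - 1)) := by ring
        _ ≤ 2 * (2 * lam - 1) * ((n : ℝ) - 2) * ρ * (2 * ρ / ((n : ℝ) - 1) ^ 2) :=
            mul_le_mul_of_nonneg_left hGn (mul_nonneg hcoef hρ0)
        _ = (4 * (2 * lam - 1) * ((n : ℝ) - 2) * ρ ^ 2) / ((n : ℝ) - 1) ^ 2 := by ring
        _ ≤ 12 * (lam - 1) * ρ ^ 2 / n := by
            rw [div_le_div_iff₀ (by positivity) hn0]
            have esq : ((n : ℝ) - 1) ^ 2 = ((n : ℝ) - 2) * n + 1 := by ring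
            have e1 : (2 * lam - 1) * (((n : ℝ) - 2) * n) ≤ (3 * (lam - 1)) * ((n : ℝ) - 1) ^ 2 :=
              mul_le_mul (by linarith) (by linarith) (mul_nonneg (by linarith) hn0.le) (by linarith)
            have e2 := mul_le_mul_of_nonneg_right e1 (sq_nonneg ρ)
            linarith
  have p3 : |(-(lam - 1)) * ∑ i ∈ Finset.Ico 2 n, G i * ((n : ℝ) - i) * q (n - i)| * ρ ^ n
      ≤ (lam - 1) * (96 * ρ ^ 2 / n) := by
    rw [abs_mul, abs_neg, abs_of_pos hl1, mul_assoc]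
    exact mul_le_mul_of_nonneg_left hS3 hl1.le
  have p4 : |2 * (lam - 1) * (((n : ℝ) - 1) * q (n - 1) + G 1 * ((n : ℝ) - 2) * q (n - 2)
              + ∑ i ∈ Finset.Ico 2 (n - 1), G i * ((n : ℝ) - 1 - i) * q (n - 1 - i))| * ρ ^ n
      ≤ 2 * (lam - 1) * (17 * ρ ^ 2 / n) := by
    rw [abs_mul, abs_of_pos (by positivity : 0 < 2 * (lam - 1)), mul_assoc]
    exact mul_le_mul_of_nonneg_left hS4 (by positivity)
  have p5 : |(-(lam * (lam - 1))) * ∑ i ∈ Finset.Ico 1 n, q i * q (n - i)| * ρ ^ n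
      ≤ 1366 * (lam - 1) * ρ ^ 2 / n := by
    rw [abs_mul, abs_neg, abs_of_pos (mul_pos hl0 hl1), mul_assoc]
    calc lam * (lam - 1) * (|∑ i ∈ Finset.Ico 1 n, q i * q (n - i)| * ρ ^ n)
        ≤ lam * (lam - 1) * (2731 * ρ ^ 2 * ω) :=
          mul_le_mul_of_nonneg_left hS5 (mul_pos hl0 hl1).le
      _ = 2731 * (lam - 1) * ρ ^ 2 * (lam * ω) := by ring
      _ ≤ 2731 * (lam - 1) * ρ ^ 2 * (1 / (2 * n)) :=
          mul_le_mul_of_nonneg_left hlamω (by positivity)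
      _ ≤ 1366 * (lam - 1) * ρ ^ 2 / n := by
          rw [mul_one_div, div_le_div_iff₀ (by positivity) hn0]
          have := mul_nonneg (mul_nonneg hl1.le (sq_nonneg ρ)) hn0.le
          linarith
  have p6 : |(3 * lam - 1) * ∑ i ∈ Finset.Ico 1 n, α i * q (n - i)| * ρ ^ n
      ≤ 960 * (lam - 1) * ρ ^ 2 / n := by
    rw [abs_mul, abs_of_pos (by linarith : 0 < 3 * lam - 1), mul_assoc]
    calc (3 * lam - 1) * (|∑ i ∈ Finset.Ico 1 n, α i * q (n - i)| * ρ ^ n)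
        ≤ (3 * lam - 1) * (192 * ρ ^ 2 / n) := mul_le_mul_of_nonneg_left hS6 (by linarith)
      _ ≤ (5 * (lam - 1)) * (192 * ρ ^ 2 / n) :=
          mul_le_mul_of_nonneg_right (by linarith) (by positivity)
      _ = 960 * (lam - 1) * ρ ^ 2 / n := by ring
  have p7 : |lam * ∑ i ∈ Finset.Ico 1 (n - 1), α i * ∑ j ∈ Finset.Ico 1 (n - i), q j * q (n - i - j)|
        * ρ ^ n ≤ 6 * (lam - 1) * ρ ^ 2 / n := by
    rw [abs_mul, abs_of_pos hl0, mul_assoc]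
    calc lam * (|∑ i ∈ Finset.Ico 1 (n - 1), α i * ∑ j ∈ Finset.Ico 1 (n - i), q j * q (n - i - j)|
          * ρ ^ n)
        ≤ lam * (3 * ρ ^ 2 / n) := mul_le_mul_of_nonneg_left hS7 hl0.le
      _ ≤ (2 * (lam - 1)) * (3 * ρ ^ 2 / n) :=
          mul_le_mul_of_nonneg_right (by linarith) (by positivity)
      _ = 6 * (lam - 1) * ρ ^ 2 / n := by ring
  have p8 : |(lam - 1) * (2 * lam - 1 + n) * ∑ i ∈ Finset.Ico 2 n, G i * q (n - i)| * ρ ^ n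
      ≤ 512 * (lam - 1) * ρ ^ 2 / n := by
    rw [abs_mul, abs_of_pos hpiv, mul_assoc]
    calc (lam - 1) * (2 * lam - 1 + n) * (|∑ i ∈ Finset.Ico 2 n, G i * q (n - i)| * ρ ^ n)
        ≤ (lam - 1) * (2 * lam - 1 + n) * (512 * ρ ^ 2 * ω) :=
          mul_le_mul_of_nonneg_left hconv hpiv.le
      _ = 512 * (lam - 1) * ρ ^ 2 * ((2 * lam - 1 + n) * ω) := by ring
      _ = 512 * (lam - 1) * ρ ^ 2 / n := by rw [hωD, mul_one_div]
  -- collect: piv |H n| ρ^n ≤ T0 + coupling + E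
  have hcollect : (lam - 1) * (2 * lam - 1 + n) * (|H n| * ρ ^ n)
      ≤ lam * |2 * lam - 1 - n| * (2 * ρ / (n : ℝ) ^ 2) + 96 * lam * (lam - 1) * θ * ρ * ω
        + 2986 * (lam - 1) * ρ ^ 2 / n := by
    have e : (lam - 1) * (2 * lam - 1 + n) * (|H n| * ρ ^ n)
        = |(lam - 1) * (2 * lam - 1 + n) * H n| * ρ ^ n := by
      rw [abs_mul, abs_of_pos hpiv]; ring
    rw [e]
    refine habs.trans ?_
    have e96 : (lam - 1) * (96 * ρ ^ 2 / n) = 96 * (lam - 1) * ρ ^ 2 / n := by ring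
    have e34 : 2 * (lam - 1) * (17 * ρ ^ 2 / n) = 34 * (lam - 1) * ρ ^ 2 / n := by ring
    have e2986 : 2986 * (lam - 1) * ρ ^ 2 / n = 12 * (lam - 1) * ρ ^ 2 / n
        + 96 * (lam - 1) * ρ ^ 2 / n + 34 * (lam - 1) * ρ ^ 2 / n + 1366 * (lam - 1) * ρ ^ 2 / n
        + 960 * (lam - 1) * ρ ^ 2 / n + 6 * (lam - 1) * ρ ^ 2 / n + 512 * (lam - 1) * ρ ^ 2 / n := by
      ring
    rw [e96] at p3
    rw [e34] at p4
    rw [e2986]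
    linarith [p0, p1, p2, p3, p4, p5, p6, p7, p8]
  -- room from schedule and drift
  have h9 : (9 : ℝ) ≤ (2 * lam - 1) ^ 2 := by
    have h3 : (3 : ℝ) ≤ 2 * lam - 1 := by linarith
    calc (9 : ℝ) = 3 * 3 := by norm_num
      _ ≤ (2 * lam - 1) * (2 * lam - 1) := mul_le_mul h3 h3 (by norm_num) (by linarith)
      _ = (2 * lam - 1) ^ 2 := by ring
  have hτ0 : 0 < 1 - 2 / (2 * lam - 1) ^ 2 := by
    rw [sub_pos, div_lt_one (by positivity)]; linarith
  have hτ1 : 1 - 2 / (2 * lam - 1) ^ 2 ≤ 1 := by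
    have : 0 ≤ 2 / (2 * lam - 1) ^ 2 := by positivity
    linarith
  have hΔ0 : 0 ≤ (2 * lam - 1) / (lam * (lam - 1)) := div_nonneg (by linarith) (mul_pos hl0 hl1).le
  have hd0 : 0 ≤ (2 * lam - 1) / (lam * (lam - 1)) / B := div_nonneg hΔ0 hB0.le
  have hroom := step_room hτ0 hτ1 (s := 2 / (2 * lam - 1) ^ 2) (by ring) hd0 n (by omega)
  set σp : ℝ := ((1 + (2 * lam - 1) / (lam * (lam - 1)) / B) / (1 - 2 / (2 * lam - 1) ^ 2)) ^ (n - 1)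
    with hσp
  have hs0 : 0 ≤ ((n : ℝ) - 1) * (2 / (2 * lam - 1) ^ 2) :=
    mul_nonneg (by linarith) (by positivity)
  have hdn0 : 0 ≤ ((n : ℝ) - 1) * ((2 * lam - 1) / (lam * (lam - 1)) / B) :=
    mul_nonneg (by linarith) hd0
  have h1σ : 1 ≤ σp := by linarith
  set P : ℝ := 2 * ρ / (n : ℝ) ^ 2 with hP
  have hP0 : 0 < P := by positivity
  have hsmallθ : 48 * θ + 2986 * ρ ≤ 1 := by linarith
  -- main comparison: piv |H n| ρ^n ≤ piv P σp
  have hmain : (lam - 1) * (2 * lam - 1 + n) * (|H n| * ρ ^ n)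
      ≤ (lam - 1) * (2 * lam - 1 + n) * (P * σp) := by
    refine hcollect.trans ?_
    rcases Nat.lt_or_ge n (2 * L) with hA | hB'
    · -- Case A : n ≤ 2λ - 1, damping
      have hnA : (n : ℝ) ≤ 2 * lam - 1 := by
        have : (n : ℝ) + 1 ≤ 2 * (L : ℝ) := by exact_mod_cast (by omega : n + 1 ≤ 2 * L)
        rw [hL] at this; linarith
      rw [abs_of_nonneg (by linarith : 0 ≤ 2 * lam - 1 - n)]
      -- coupling ≤ 48 (λ-1) θ ρ / n
      have hc : 96 * lam * (lam - 1) * θ * ρ * ω ≤ 48 * (lam - 1) * θ * ρ * (1 / n) := by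
        calc 96 * lam * (lam - 1) * θ * ρ * ω = 96 * (lam - 1) * θ * ρ * (lam * ω) := by ring
          _ ≤ 96 * (lam - 1) * θ * ρ * (1 / (2 * n)) :=
              mul_le_mul_of_nonneg_left hlamω (by positivity)
          _ = 48 * (lam - 1) * θ * ρ * (1 / n) := by field_simp; ring
      -- the small terms against (2λ-1)(n-1) P
      have hkey : 48 * (lam - 1) * θ * ρ * (1 / n) + 2986 * (lam - 1) * ρ ^ 2 / n
          ≤ (2 * lam - 1) * ((n : ℝ) - 1) * P := by
        have e1 : 48 * (lam - 1) * θ * ρ * (1 / n) + 2986 * (lam - 1) * ρ ^ 2 / n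
            = ((lam - 1) * ρ * (48 * θ + 2986 * ρ)) * n / (n : ℝ) ^ 2 := by
          field_simp
        have e2 : (2 * lam - 1) * ((n : ℝ) - 1) * P = (2 * (2 * lam - 1) * ((n : ℝ) - 1) * ρ) / (n : ℝ) ^ 2 := by
          rw [hP]; ring
        rw [e1, e2, div_le_div_iff_of_pos_right (by positivity)]
        have f1 : (lam - 1) * ρ * (48 * θ + 2986 * ρ) ≤ (lam - 1) * ρ :=
          mul_le_of_le_one_right (mul_nonneg hl1.le hρ0) hsmallθ
        have f2 : (lam - 1) * (n : ℝ) ≤ 2 * (2 * lam - 1) * ((n : ℝ) - 1) := by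
          have := mul_nonneg (sub_nonneg.2 hlam) (by linarith : (0:ℝ) ≤ 3 * (n : ℝ) - 4)
          linarith
        calc (lam - 1) * ρ * (48 * θ + 2986 * ρ) * n ≤ (lam - 1) * ρ * n :=
              mul_le_mul_of_nonneg_right f1 hn0.le
          _ = ((lam - 1) * (n : ℝ)) * ρ := by ring
          _ ≤ (2 * (2 * lam - 1) * ((n : ℝ) - 1)) * ρ := mul_le_mul_of_nonneg_right f2 hρ0
          _ = 2 * (2 * lam - 1) * ((n : ℝ) - 1) * ρ := by ring
      have hpivP : 0 ≤ (lam - 1) * (2 * lam - 1 + n) * P := (mul_pos hpiv hP0).le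
      calc lam * (2 * lam - 1 - n) * P + 96 * lam * (lam - 1) * θ * ρ * ω + 2986 * (lam - 1) * ρ ^ 2 / n
          ≤ lam * (2 * lam - 1 - n) * P + (2 * lam - 1) * ((n : ℝ) - 1) * P := by linarith
        _ = (lam - 1) * (2 * lam - 1 + n) * P * 1 := by ring
        _ ≤ (lam - 1) * (2 * lam - 1 + n) * P * σp := mul_le_mul_of_nonneg_left h1σ hpivP
        _ = (lam - 1) * (2 * lam - 1 + n) * (P * σp) := by ring
    · -- Case B : n ≥ 2λ, the ã-coefficient helps; use (G)
      have hnB : 2 * lam ≤ (n : ℝ) := by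
        have : 2 * (L : ℝ) ≤ (n : ℝ) := by exact_mod_cast hB'
        rw [hL] at this; exact this
      rw [abs_of_nonpos (by linarith : 2 * lam - 1 - n ≤ 0)]
      -- (G) multiplied by piv
      have hGn := hGc n hB'
      have hG' := mul_le_mul_of_nonneg_left hGn hpiv.le
      have eL : (lam - 1) * (2 * lam - 1 + n) * (3 * lam / (2 * lam - 1 + n)) = 3 * lam * (lam - 1) := by
        calc (lam - 1) * (2 * lam - 1 + n) * (3 * lam / (2 * lam - 1 + n))
            = (lam - 1) * ((2 * lam - 1 + n) * (3 * lam) / (2 * lam - 1 + n)) := by ring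
          _ = (lam - 1) * (3 * lam) := by rw [mul_div_cancel_left₀ _ hD.ne']
          _ = 3 * lam * (lam - 1) := by ring
      have eR : (lam - 1) * (2 * lam - 1 + n) * (2 * ((n : ℝ) - 1) / (2 * lam - 1) ^ 2 + 1
            - lam * ((n : ℝ) + 1 - 2 * lam) / ((lam - 1) * (2 * lam - 1 + n)))
          = (lam - 1) * (2 * lam - 1 + n) * (1 + ((n : ℝ) - 1) * (2 / (2 * lam - 1) ^ 2))
            - lam * ((n : ℝ) + 1 - 2 * lam) := by
        set t : ℝ := lam * ((n : ℝ) + 1 - 2 * lam) / ((lam - 1) * (2 * lam - 1 + n)) with ht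
        have hc : (lam - 1) * (2 * lam - 1 + n) * t = lam * ((n : ℝ) + 1 - 2 * lam) := by
          rw [ht, ← mul_div_assoc, mul_div_cancel_left₀ _ hpiv.ne']
        calc (lam - 1) * (2 * lam - 1 + n) * (2 * ((n : ℝ) - 1) / (2 * lam - 1) ^ 2 + 1 - t)
            = (lam - 1) * (2 * lam - 1 + n) * (2 * ((n : ℝ) - 1) / (2 * lam - 1) ^ 2 + 1)
              - (lam - 1) * (2 * lam - 1 + n) * t := by ring
          _ = (lam - 1) * (2 * lam - 1 + n) * (2 * ((n : ℝ) - 1) / (2 * lam - 1) ^ 2 + 1)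
              - lam * ((n : ℝ) + 1 - 2 * lam) := by rw [hc]
          _ = _ := by ring
      rw [eL, eR] at hG'
      -- coupling ≤ 3λ(λ-1) P
      have hc : 96 * lam * (lam - 1) * θ * ρ * ω ≤ 3 * lam * (lam - 1) * P := by
        have hθn : θ * (n : ℝ) ≤ 1 / 1024 * n := mul_le_mul_of_nonneg_right hθle hn0.le
        have h96 : 96 * θ * ω ≤ 6 / (n : ℝ) ^ 2 := by
          rw [hωdef, mul_one_div, div_le_div_iff₀ (mul_pos hn0 hD) (by positivity)]
          have hin : (0:ℝ) ≤ 6 * (2 * lam - 1 + n) - 96 * θ * n := by linarith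
          have := mul_nonneg hn0.le hin
          linarith
        calc 96 * lam * (lam - 1) * θ * ρ * ω = lam * (lam - 1) * ρ * (96 * θ * ω) := by ring
          _ ≤ lam * (lam - 1) * ρ * (6 / (n : ℝ) ^ 2) :=
              mul_le_mul_of_nonneg_left h96 (by positivity)
          _ = 3 * lam * (lam - 1) * P := by rw [hP]; ring
      -- E ≤ drift room
      have hE : 2986 * (lam - 1) * ρ ^ 2 / n
          ≤ (lam - 1) * (2 * lam - 1 + n) * P
              * (((n : ℝ) - 1) * ((2 * lam - 1) / (lam * (lam - 1)) / B)) := by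
        have eL' : 2986 * (lam - 1) * ρ ^ 2 / n
            = (2986 * θ) * (lam * (lam - 1) * n) * (ρ / (lam * B * (n : ℝ) ^ 2)) := by
          rw [← hρB]; field_simp
        have eR' : (lam - 1) * (2 * lam - 1 + n) * P
              * (((n : ℝ) - 1) * ((2 * lam - 1) / (lam * (lam - 1)) / B))
            = (2 * ((n : ℝ) - 1) * (2 * lam - 1) * (2 * lam - 1 + n)) * (ρ / (lam * B * (n : ℝ) ^ 2)) := by
          rw [hP]; field_simp
        rw [eL', eR']
        refine mul_le_mul_of_nonneg_right ?_
          (div_nonneg hρ0 (mul_nonneg (mul_nonneg hl0.le hB0.le) (sq_nonneg _)))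
        have h3 : 2986 * θ ≤ 3 := by linarith
        have hlln : 0 ≤ lam * (lam - 1) * n := by positivity
        calc 2986 * θ * (lam * (lam - 1) * n) ≤ 3 * (lam * (lam - 1) * n) :=
              mul_le_mul_of_nonneg_right h3 hlln
          _ ≤ 3 * (lam * (lam - 1) * (2 * ((n : ℝ) - 1))) := by
              have := mul_nonneg (mul_pos hl0 hl1).le (by linarith : (0:ℝ) ≤ (n:ℝ) - 2)
              linarith
          _ = (6 * lam * (lam - 1)) * ((n : ℝ) - 1) := by ring
          _ ≤ (2 * (2 * lam - 1) * (4 * lam - 1)) * ((n : ℝ) - 1) := by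
              have := mul_le_mul_of_nonneg_left hlam hl0.le
              exact mul_le_mul_of_nonneg_right (by linarith) (by linarith)
          _ ≤ (2 * (2 * lam - 1) * (2 * lam - 1 + n)) * ((n : ℝ) - 1) := by
              apply mul_le_mul_of_nonneg_right _ (by linarith)
              apply mul_le_mul_of_nonneg_left _ (by linarith)
              linarith
          _ = 2 * ((n : ℝ) - 1) * (2 * lam - 1) * (2 * lam - 1 + n) := by ring
      have hpivP : 0 ≤ (lam - 1) * (2 * lam - 1 + n) * P := (mul_pos hpiv hP0).le
      have hG'' := mul_le_mul_of_nonneg_right hG' hP0.le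
      calc lam * (-(2 * lam - 1 - n)) * P + 96 * lam * (lam - 1) * θ * ρ * ω
            + 2986 * (lam - 1) * ρ ^ 2 / n
          ≤ lam * ((n : ℝ) + 1 - 2 * lam) * P + 3 * lam * (lam - 1) * P
            + (lam - 1) * (2 * lam - 1 + n) * P
              * (((n : ℝ) - 1) * ((2 * lam - 1) / (lam * (lam - 1)) / B)) := by linarith
        _ ≤ (lam - 1) * (2 * lam - 1 + n) * P
              * (1 + ((n : ℝ) - 1) * (2 / (2 * lam - 1) ^ 2)
                + ((n : ℝ) - 1) * ((2 * lam - 1) / (lam * (lam - 1)) / B)) := by linarith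
        _ ≤ (lam - 1) * (2 * lam - 1 + n) * P * σp := mul_le_mul_of_nonneg_left hroom hpivP
        _ = (lam - 1) * (2 * lam - 1 + n) * (P * σp) := by ring
  exact le_of_mul_le_mul_left hmain hpiv

end HStep

end Summit.FinalStateConjecture.FinalStateConjecture.Theorems.CrumPeelingRecessiveTower
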